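import Mathlib
import HarnessLib
import Summits.AtomisticToContinuum.HydrodynamicLimit.Theses.RelayRaceLocality
import Literature.MathematicalPhysics.KineticTheory.HardSphereEulerProofs

/-!
# RelayRaceLocality · ConeLocalisation — assembling the LLN from local test functions

Support file for item `stmt-AtomisticToContinuum-12504` (`ConeLocalisation`, route
RelayRaceLocality of `AtomisticToContinuum/HydrodynamicLimit`).

The last step of the glue ("a partition of unity over `x₀` finishes"): the light cone delivers
the three-field law of large numbers at time `t` only for test functions supported in small balls;
`TendstoHydroFieldsAt … t` asks for it for EVERY continuous `χ`. Since the empirical fields and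
the Euler targets are linear in `χ`, and deviation events split under sums (union bound at half
the threshold), convergence in probability for `χ₁` and `χ₂` gives it for `χ₁ + χ₂`, hence for
finite sums, hence for every continuous `χ` that is a finite sum of "local" test functions.
-/

namespace Summit.AtomisticToContinuum.HydrodynamicLimit.Theorems

open scoped Topology ENNReal
open Filter Set MeasureTheory
open Literature.MathematicalPhysics.KineticTheory Literature.Analysis.FluidPDE

/-- Splitting of deviation events, norm form with strict thresholds: if `P_N(η < ‖A_N‖) → 0` and
`P_N(η < ‖B_N‖) → 0` then `P_N(2η < ‖A_N + B_N‖) → 0`. [folklore] -/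
theorem relayRaceLocality_tendsto_measure_lt_norm_add {Ω : ℕ → Type*} [∀ N, MeasurableSpace (Ω N)]
    {G : Type*} [SeminormedAddCommGroup G]
    {P : (N : ℕ) → Measure (Ω N)} {A B : (N : ℕ) → Ω N → G} {η : ℝ}
    (hA : Tendsto (fun N => P N {z | η < ‖A N z‖}) atTop (𝓝 0))
    (hB : Tendsto (fun N => P N {z | η < ‖B N z‖}) atTop (𝓝 0)) :
    Tendsto (fun N => P N {z | 2 * η < ‖A N z + B N z‖}) atTop (𝓝 0) := by
  refine tendsto_of_tendsto_of_tendsto_of_le_of_le tendsto_const_nhds (by simpa using hA.add hB)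
    (fun N => zero_le) (fun N => ?_)
  calc P N {z | 2 * η < ‖A N z + B N z‖}
      ≤ P N ({z | η < ‖A N z‖} ∪ {z | η < ‖B N z‖}) := by
        refine measure_mono fun z hz => ?_
        simp only [Set.mem_setOf_eq, Set.mem_union] at hz ⊢
        by_contra h
        push Not at h
        have := norm_add_le (A N z) (B N z)
        linarith [h.1, h.2]
    _ ≤ P N {z | η < ‖A N z‖} + P N {z | η < ‖B N z‖} := measure_union_le _ _

/-- Splitting of deviation events, absolute-value form with strict thresholds. [folklore] -/
theorem relayRaceLocality_tendsto_measure_lt_abs_add {Ω : ℕ → Type*} [∀ N, MeasurableSpace (Ω N)]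
    {P : (N : ℕ) → Measure (Ω N)} {A B : (N : ℕ) → Ω N → ℝ} {η : ℝ}
    (hA : Tendsto (fun N => P N {z | η < |A N z|}) atTop (𝓝 0))
    (hB : Tendsto (fun N => P N {z | η < |B N z|}) atTop (𝓝 0)) :
    Tendsto (fun N => P N {z | 2 * η < |A N z + B N z|}) atTop (𝓝 0) :=
  relayRaceLocality_tendsto_measure_lt_norm_add (G := ℝ) hA hB

section Fields

variable {N : ℕ}

/-- The empirical density field is additive in the test function. [folklore] -/
theorem relayRaceLocality_empiricalDensityField_add (z : Config N (Fin 3) T3) (χ₁ χ₂ : T3 → ℝ) :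
    empiricalDensityField z (χ₁ + χ₂) = empiricalDensityField z χ₁ + empiricalDensityField z χ₂ := by
  simp only [empiricalDensityField_eq_sum, Pi.add_apply, Finset.sum_add_distrib, mul_add]

/-- The empirical momentum field is additive in the test function. [folklore] -/
theorem relayRaceLocality_empiricalMomentumField_add (z : Config N (Fin 3) T3) (χ₁ χ₂ : T3 → ℝ) :
    empiricalMomentumField z (χ₁ + χ₂) =
      empiricalMomentumField z χ₁ + empiricalMomentumField z χ₂ := by
  simp only [empiricalMomentumField_eq_sum, Pi.add_apply, add_smul, Finset.sum_add_distrib, smul_add]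

/-- The empirical energy field is additive in the test function. [folklore] -/
theorem relayRaceLocality_empiricalEnergyField_add (z : Config N (Fin 3) T3) (χ₁ χ₂ : T3 → ℝ) :
    empiricalEnergyField z (χ₁ + χ₂) = empiricalEnergyField z χ₁ + empiricalEnergyField z χ₂ := by
  simp only [empiricalEnergyField_eq_sum, Pi.add_apply, add_mul, Finset.sum_add_distrib, mul_add]

/-- The empirical density field of the zero test function vanishes. [folklore] -/
theorem relayRaceLocality_empiricalDensityField_zero (z : Config N (Fin 3) T3) :
    empiricalDensityField z 0 = 0 := by
  simp [empiricalDensityField_eq_sum]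

/-- The empirical momentum field of the zero test function vanishes. [folklore] -/
theorem relayRaceLocality_empiricalMomentumField_zero (z : Config N (Fin 3) T3) :
    empiricalMomentumField z 0 = 0 := by
  simp [empiricalMomentumField_eq_sum]

/-- The empirical energy field of the zero test function vanishes. [folklore] -/
theorem relayRaceLocality_empiricalEnergyField_zero (z : Config N (Fin 3) T3) :
    empiricalEnergyField z 0 = 0 := by
  simp [empiricalEnergyField_eq_sum]

end Fields

variable {ε : ℕ → ℝ} {P : (N : ℕ) → Measure (Config (N + 1) (Fin 3) T3)}
  {Φ : (N : ℕ) → HardSphereFlow (Torus.geometry (Fin 3)) (ε N) (N + 1)}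
  {ρ θ : ℝ → T3 → ℝ} {u : ℝ → T3 → V3} {t : ℝ}

/-- **Additivity of the three-field LLN in the test function.** At a fixed time `t`, if the
empirical density / momentum / energy fields converge in probability to the Euler targets for the
continuous test functions `χ₁` and `χ₂` (time-`t` slices of `ρ, u, θ` continuous), then they do
for `χ₁ + χ₂`. [folklore] -/
theorem relayRaceLocality_hydroFields_test_add (hρ : Continuous (ρ t)) (hu : Continuous (u t))
    (hθ : Continuous (θ t)) {χ₁ χ₂ : T3 → ℝ} (hχ₁ : Continuous χ₁) (hχ₂ : Continuous χ₂)
    (h₁ : ∀ δ : ℝ, 0 < δ →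
      Tendsto (fun N => P N {z | δ < |empiricalDensityField ((Φ N).flow t z) χ₁ -
        ∫ x, χ₁ x * ρ t x|}) atTop (𝓝 0) ∧
      Tendsto (fun N => P N {z | δ < ‖empiricalMomentumField ((Φ N).flow t z) χ₁ -
        ∫ x, (χ₁ x * ρ t x) • u t x‖}) atTop (𝓝 0) ∧
      Tendsto (fun N => P N {z | δ < |empiricalEnergyField ((Φ N).flow t z) χ₁ -
        ∫ x, χ₁ x * totalEnergyDensity (ρ t x) (u t x) (θ t x)|}) atTop (𝓝 0))
    (h₂ : ∀ δ : ℝ, 0 < δ →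
      Tendsto (fun N => P N {z | δ < |empiricalDensityField ((Φ N).flow t z) χ₂ -
        ∫ x, χ₂ x * ρ t x|}) atTop (𝓝 0) ∧
      Tendsto (fun N => P N {z | δ < ‖empiricalMomentumField ((Φ N).flow t z) χ₂ -
        ∫ x, (χ₂ x * ρ t x) • u t x‖}) atTop (𝓝 0) ∧
      Tendsto (fun N => P N {z | δ < |empiricalEnergyField ((Φ N).flow t z) χ₂ -
        ∫ x, χ₂ x * totalEnergyDensity (ρ t x) (u t x) (θ t x)|}) atTop (𝓝 0)) :
    ∀ δ : ℝ, 0 < δ →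
      Tendsto (fun N => P N {z | δ < |empiricalDensityField ((Φ N).flow t z) (χ₁ + χ₂) -
        ∫ x, (χ₁ + χ₂) x * ρ t x|}) atTop (𝓝 0) ∧
      Tendsto (fun N => P N {z | δ < ‖empiricalMomentumField ((Φ N).flow t z) (χ₁ + χ₂) -
        ∫ x, ((χ₁ + χ₂) x * ρ t x) • u t x‖}) atTop (𝓝 0) ∧
      Tendsto (fun N => P N {z | δ < |empiricalEnergyField ((Φ N).flow t z) (χ₁ + χ₂) -
        ∫ x, (χ₁ + χ₂) x * totalEnergyDensity (ρ t x) (u t x) (θ t x)|}) atTop (𝓝 0) := by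
  intro δ hδ
  obtain ⟨d₁, m₁, e₁⟩ := h₁ (δ / 2) (by positivity)
  obtain ⟨d₂, m₂, e₂⟩ := h₂ (δ / 2) (by positivity)
  have h2 : (2 : ℝ) * (δ / 2) = δ := by ring
  have hE : Continuous fun x => totalEnergyDensity (ρ t x) (u t x) (θ t x) := by
    unfold totalEnergyDensity
    fun_prop
  -- integrability of the targets
  have iρ₁ : Integrable (fun x => χ₁ x * ρ t x) := integrable_of_continuous_T3 (hχ₁.mul hρ)
  have iρ₂ : Integrable (fun x => χ₂ x * ρ t x) := integrable_of_continuous_T3 (hχ₂.mul hρ)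
  have iu₁ : Integrable (fun x => (χ₁ x * ρ t x) • u t x) :=
    integrable_of_continuous_T3 ((hχ₁.mul hρ).smul hu)
  have iu₂ : Integrable (fun x => (χ₂ x * ρ t x) • u t x) :=
    integrable_of_continuous_T3 ((hχ₂.mul hρ).smul hu)
  have iE₁ : Integrable (fun x => χ₁ x * totalEnergyDensity (ρ t x) (u t x) (θ t x)) :=
    integrable_of_continuous_T3 (hχ₁.mul hE)
  have iE₂ : Integrable (fun x => χ₂ x * totalEnergyDensity (ρ t x) (u t x) (θ t x)) :=
    integrable_of_continuous_T3 (hχ₂.mul hE)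
  -- linearity of the targets
  have tρ : ∫ x, (χ₁ + χ₂) x * ρ t x = (∫ x, χ₁ x * ρ t x) + ∫ x, χ₂ x * ρ t x := by
    rw [← integral_add iρ₁ iρ₂]
    exact integral_congr_ae (ae_of_all _ fun x => by simp [add_mul])
  have tu : ∫ x, ((χ₁ + χ₂) x * ρ t x) • u t x =
      (∫ x, (χ₁ x * ρ t x) • u t x) + ∫ x, (χ₂ x * ρ t x) • u t x := by
    rw [← integral_add iu₁ iu₂]
    exact integral_congr_ae (ae_of_all _ fun x => by simp [add_mul, add_smul])
  have tE : ∫ x, (χ₁ + χ₂) x * totalEnergyDensity (ρ t x) (u t x) (θ t x) =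
      (∫ x, χ₁ x * totalEnergyDensity (ρ t x) (u t x) (θ t x)) +
        ∫ x, χ₂ x * totalEnergyDensity (ρ t x) (u t x) (θ t x) := by
    rw [← integral_add iE₁ iE₂]
    exact integral_congr_ae (ae_of_all _ fun x => by simp [add_mul])
  refine ⟨?_, ?_, ?_⟩
  · refine (relayRaceLocality_tendsto_measure_lt_abs_add d₁ d₂).congr fun N => ?_
    congr 1
    ext z
    simp only [Set.mem_setOf_eq, h2, relayRaceLocality_empiricalDensityField_add, tρ]
    ring_nf
  · refine (relayRaceLocality_tendsto_measure_lt_norm_add m₁ m₂).congr fun N => ?_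
    congr 1
    ext z
    simp only [Set.mem_setOf_eq, h2, relayRaceLocality_empiricalMomentumField_add, tu]
    congr! 2
    abel
  · refine (relayRaceLocality_tendsto_measure_lt_abs_add e₁ e₂).congr fun N => ?_
    congr 1
    ext z
    simp only [Set.mem_setOf_eq, h2, relayRaceLocality_empiricalEnergyField_add, tE]
    ring_nf

/-- The three-field LLN holds trivially for the zero test function. [folklore] -/
theorem relayRaceLocality_hydroFields_test_zero :
    ∀ δ : ℝ, 0 < δ →
      Tendsto (fun N => P N {z | δ < |empiricalDensityField ((Φ N).flow t z) 0 -
        ∫ x, (0 : T3 → ℝ) x * ρ t x|}) atTop (𝓝 0) ∧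
      Tendsto (fun N => P N {z | δ < ‖empiricalMomentumField ((Φ N).flow t z) 0 -
        ∫ x, ((0 : T3 → ℝ) x * ρ t x) • u t x‖}) atTop (𝓝 0) ∧
      Tendsto (fun N => P N {z | δ < |empiricalEnergyField ((Φ N).flow t z) 0 -
        ∫ x, (0 : T3 → ℝ) x * totalEnergyDensity (ρ t x) (u t x) (θ t x)|}) atTop (𝓝 0) := by
  intro δ hδ
  refine ⟨?_, ?_, ?_⟩
  · refine tendsto_const_nhds.congr fun N => ?_
    rw [show {z | δ < |empiricalDensityField ((Φ N).flow t z) 0 - ∫ x, (0 : T3 → ℝ) x * ρ t x|} =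
      (∅ : Set (Config (N + 1) (Fin 3) T3)) from ?_, measure_empty]
    ext z
    simp [relayRaceLocality_empiricalDensityField_zero, hδ.le.not_gt]
  · refine tendsto_const_nhds.congr fun N => ?_
    rw [show {z | δ < ‖empiricalMomentumField ((Φ N).flow t z) 0 -
        ∫ x, ((0 : T3 → ℝ) x * ρ t x) • u t x‖} = (∅ : Set (Config (N + 1) (Fin 3) T3)) from ?_,
      measure_empty]
    ext z
    simp [relayRaceLocality_empiricalMomentumField_zero, hδ.le.not_gt]
  · refine tendsto_const_nhds.congr fun N => ?_
    rw [show {z | δ < |empiricalEnergyField ((Φ N).flow t z) 0 -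
        ∫ x, (0 : T3 → ℝ) x * totalEnergyDensity (ρ t x) (u t x) (θ t x)|} =
        (∅ : Set (Config (N + 1) (Fin 3) T3)) from ?_, measure_empty]
    ext z
    simp [relayRaceLocality_empiricalEnergyField_zero, hδ.le.not_gt]

/-- **Finite sums of test functions.** At a fixed time `t` (continuous slices), if the
three-field LLN holds for each continuous `ψ k`, `k ∈ s`, it holds for `∑ k ∈ s, ψ k`. [folklore] -/
theorem relayRaceLocality_hydroFields_test_sum (hρ : Continuous (ρ t)) (hu : Continuous (u t))
    (hθ : Continuous (θ t)) {ι : Type*} (s : Finset ι) (ψ : ι → T3 → ℝ)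
    (hψ : ∀ k ∈ s, Continuous (ψ k))
    (h : ∀ k ∈ s, ∀ δ : ℝ, 0 < δ →
      Tendsto (fun N => P N {z | δ < |empiricalDensityField ((Φ N).flow t z) (ψ k) -
        ∫ x, ψ k x * ρ t x|}) atTop (𝓝 0) ∧
      Tendsto (fun N => P N {z | δ < ‖empiricalMomentumField ((Φ N).flow t z) (ψ k) -
        ∫ x, (ψ k x * ρ t x) • u t x‖}) atTop (𝓝 0) ∧
      Tendsto (fun N => P N {z | δ < |empiricalEnergyField ((Φ N).flow t z) (ψ k) -
        ∫ x, ψ k x * totalEnergyDensity (ρ t x) (u t x) (θ t x)|}) atTop (𝓝 0)) :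
    ∀ δ : ℝ, 0 < δ →
      Tendsto (fun N => P N {z | δ < |empiricalDensityField ((Φ N).flow t z) (∑ k ∈ s, ψ k) -
        ∫ x, (∑ k ∈ s, ψ k) x * ρ t x|}) atTop (𝓝 0) ∧
      Tendsto (fun N => P N {z | δ < ‖empiricalMomentumField ((Φ N).flow t z) (∑ k ∈ s, ψ k) -
        ∫ x, ((∑ k ∈ s, ψ k) x * ρ t x) • u t x‖}) atTop (𝓝 0) ∧
      Tendsto (fun N => P N {z | δ < |empiricalEnergyField ((Φ N).flow t z) (∑ k ∈ s, ψ k) -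
        ∫ x, (∑ k ∈ s, ψ k) x * totalEnergyDensity (ρ t x) (u t x) (θ t x)|}) atTop (𝓝 0) := by
  classical
  induction s using Finset.induction_on with
  | empty =>
    simpa only [Finset.sum_empty] using
      (relayRaceLocality_hydroFields_test_zero (P := P) (Φ := Φ) (ρ := ρ) (u := u) (θ := θ) (t := t))
  | insert a s ha ih =>
    rw [Finset.sum_insert ha]
    have hcont : Continuous (∑ k ∈ s, ψ k) :=
      (continuous_finsetSum s fun k hk => hψ k (Finset.mem_insert_of_mem hk)).congr
        fun a => (Finset.sum_apply a s ψ).symm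
    exact relayRaceLocality_hydroFields_test_add hρ hu hθ (hψ a (Finset.mem_insert_self a s)) hcont
      (h a (Finset.mem_insert_self a s))
      (ih (fun k hk => hψ k (Finset.mem_insert_of_mem hk))
        (fun k hk => h k (Finset.mem_insert_of_mem hk)))

/-- **Assembly from local test functions.** Let `𝒮` be a class of continuous test functions for
which the three-field LLN at time `t` is known (e.g. bumps supported in small balls, delivered by
the light cone). If every continuous `χ` is a finite sum of members of `𝒮` (partition of unity),
then `TendstoHydroFieldsAt P Φ ρ u θ t`. [folklore] -/
theorem relayRaceLocality_tendstoHydroFieldsAt_of_local (hρ : Continuous (ρ t))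
    (hu : Continuous (u t)) (hθ : Continuous (θ t)) (𝒮 : Set (T3 → ℝ))
    (hcont : ∀ χ ∈ 𝒮, Continuous χ)
    (hloc : ∀ χ ∈ 𝒮, ∀ δ : ℝ, 0 < δ →
      Tendsto (fun N => P N {z | δ < |empiricalDensityField ((Φ N).flow t z) χ -
        ∫ x, χ x * ρ t x|}) atTop (𝓝 0) ∧
      Tendsto (fun N => P N {z | δ < ‖empiricalMomentumField ((Φ N).flow t z) χ -
        ∫ x, (χ x * ρ t x) • u t x‖}) atTop (𝓝 0) ∧
      Tendsto (fun N => P N {z | δ < |empiricalEnergyField ((Φ N).flow t z) χ -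
        ∫ x, χ x * totalEnergyDensity (ρ t x) (u t x) (θ t x)|}) atTop (𝓝 0))
    (hgen : ∀ χ : T3 → ℝ, Continuous χ →
      ∃ (n : ℕ) (ψ : Fin n → T3 → ℝ), (∀ k, ψ k ∈ 𝒮) ∧ χ = ∑ k, ψ k) :
    TendstoHydroFieldsAt P Φ ρ u θ t := by
  intro χ hχ δ hδ
  obtain ⟨n, ψ, hψ, rfl⟩ := hgen χ hχ
  exact relayRaceLocality_hydroFields_test_sum hρ hu hθ Finset.univ ψ
    (fun k _ => hcont _ (hψ k)) (fun k _ => hloc _ (hψ k)) δ hδ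

end Summit.AtomisticToContinuum.HydrodynamicLimit.Theorems
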